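import Literature.Geometry.Lorentzian.SubdevelopmentTimelikeEntry
import HarnessLib

/-!
# A future point whose past meets the complement of the subregion only near a "spacelike"
# boundary point (Sbierski 2016, Lemma 16 "FuturePoint")

J. Sbierski, Ann. Henri Poincaré 17 (2016) 301–329 = arXiv:1309.7591v3, §3.2, Lemma 16:

> *Let `U` be a GHD of some initial data and `M ⊇ U` an extension of `U`. Suppose that there
> exists a `p ∈ ∂U` that satisfies `J⁻(p) ∩ ∂U ∩ J⁺(ι(M̄)) = {p}`. Then for every open
> neighbourhood `W` of `p` in `M` there exists a point `q ∈ I⁺(p) ⊆ M` such that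
> `J⁻(q) ∩ Uᶜ ∩ J⁺(ι(M̄)) ⊆ W`.*

Printed proof (p. 15 of the arXiv version): a future timelike curve `γ` from `p` stays outside `U`;
if the lemma failed, points `q_j ∈ J⁻(γ(t_j)) ∩ Uᶜ ∩ J⁺(ι(M̄)) ∩ Wᶜ`, `t_j → 0`, would accumulate
(compactness of `J⁻(γ(ε)) ∩ J⁺(ι(M̄))`, global hyperbolicity of `M`) at some `q ≤ p`
(closedness of `≤`) in `Uᶜ ∩ J⁺(ι(M̄)) ∩ Wᶜ`; `q ∈ ∂U` is excluded by the hypothesis on `p`, and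
`q` in the exterior of `U` *"contradicts the global hyperbolicity of `U` in the same way as we
argued in the proof of Lemma 15"* — made explicit by
`Literature.Geometry.Lorentzian.SubdevelopmentTimelikeEntry`: a point `r ≪ p` of the exterior
close to `q` would have to lie in `U`.

Here `U ⊆ M` is any open subset containing the Cauchy hypersurface `S` of `(M, g, τ)` such that
`S` is a Cauchy hypersurface of `(U, g|_U, τ|_U)` (for a common development of two Cauchy
developments: `𝔠.opens`, `S = ι(X)`). The two global-hyperbolicity consequences used by the
printed proof are DISPLAYED hypotheses, in exactly the form used: `hK`, compactness of
`J⁻(x) ∩ J⁺(S)` (Hawking–Ellis 1973, Prop. 6.6.6), and `hrel`, sequential closedness of `≤`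
(O'Neill 1983, Lemma 14.22) — neither is a theorem over the tree's Cauchy developments yet.

* `LorentzianMetric.mem_causalFuture_of_mem_causalFuture_of_mem_causalFuture` — `x ≤ y ≤ z ⇒ x ≤ z`
  pointwise (from `causalFuture_causalFuture_eq`);
* `LorentzianMetric.IsCauchyHypersurface.mem_chronologicalFuture_of_mem_causalFuture_diff` —
  `J⁺(S) ∖ S ⊆ I⁺(S)` for a Cauchy hypersurface `S`;
* `LorentzianMetric.IsCauchyHypersurface.exists_forall_Ioc_notMem_opens` — a future timelike
  curve from a point `p ∈ ∂U ∩ J⁺(S)` stays outside `U` for positive parameters;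
* `LorentzianMetric.IsCauchyHypersurface.exists_causalPast_inter_compl_subset` — **Lemma 16**.

Everything is proved; no definitions, no named facts (D-0026).

## References

* J. Sbierski, Ann. Henri Poincaré 17 (2016) 301–329 = arXiv:1309.7591v3, §3.2, Lemma 16 and
  its proof (arXiv numbering). [Sbierski2016AHP]
* B. O'Neill, *Semi-Riemannian geometry with applications to relativity*, Academic Press 1983,
  Ch. 14, Lemma 14.6, Lemma 14.22, Lemma 14.29. [ONeillSemiRiemannian1983]
* S. W. Hawking, G. F. R. Ellis, *The large scale structure of space-time*, CUP 1973, §6.6,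
  Prop. 6.6.6. [HawkingEllis1973]
-/

noncomputable section

open Set Filter Function TopologicalSpace
open scoped Manifold ContDiff Topology

namespace Literature.Geometry.Lorentzian

variable {E : Type*} [NormedAddCommGroup E] [NormedSpace ℝ E] {H : Type*} [TopologicalSpace H]
  {I : ModelWithCorners ℝ E H} {n : ℕ∞ω} {M : Type*} [TopologicalSpace M] [ChartedSpace H M]
  [IsManifold I ∞ M]

namespace LorentzianMetric

variable {g : LorentzianMetric I n M} {τ : TimeOrientation g}

/-- **`x ≤ y ≤ z ⇒ x ≤ z`** for points (transitivity of the causal relation; `J⁺(J⁺(S)) = J⁺(S)`,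
`causalFuture_causalFuture_eq`, with the corners of differentiable causal curves rounded).
O'Neill 1983, Ch. 14, p. 402. [cite: ONeillSemiRiemannian1983, Ch. 14, p. 402] -/
theorem mem_causalFuture_of_mem_causalFuture_of_mem_causalFuture [BoundarylessManifold I M]
    (hn : 2 ≤ n) {x y z : M} (hy : y ∈ g.causalFuture τ {x}) (hz : z ∈ g.causalFuture τ {y}) :
    z ∈ g.causalFuture τ {x} := by
  rw [← causalFuture_causalFuture_eq hn {x}, causalFuture_eq_biUnion]
  simp only [mem_iUnion, exists_prop]
  exact ⟨y, hy, hz⟩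

/-- **`J⁺(S) ∖ S ⊆ I⁺(S)` for a Cauchy hypersurface `S`**: a point of `J⁺(S)` off `S` lies in
`I⁺(S)` or `I⁻(S)` (`M = I⁻(S) ⊔ S ⊔ I⁺(S)`, O'Neill's Lemma 14.29), and `z ≤ x ≪ z'` with
`z, z' ∈ S` would contradict achronality by push-up. [cite: ONeillSemiRiemannian1983, Ch. 14, Lemma 14.29 (p. 415)] -/
theorem IsCauchyHypersurface.mem_chronologicalFuture_of_mem_causalFuture_diff [T2Space M]
    [SecondCountableTopology M] [BoundarylessManifold I M] [FiniteDimensional ℝ E] (hn : 2 ≤ n)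
    {S : Set M} (hS : g.IsCauchyHypersurface τ S) {x : M} (hx : x ∈ g.causalFuture τ S)
    (hxS : x ∉ S) : x ∈ g.chronologicalFuture τ S := by
  have hn1 : (1 : ℕ∞ω) ≤ n := le_trans one_le_two hn
  rcases hS.mem_chronologicalFuture_union_chronologicalPast hn hxS with h | h
  · exact h
  · exfalso
    -- `z ≤ x ≪ z'`, `z, z' ∈ S`
    obtain ⟨z, hzS, hxz⟩ : ∃ z ∈ S, x ∈ g.causalFuture τ {z} := by
      rw [causalFuture_eq_biUnion] at hx
      simpa only [mem_iUnion, exists_prop] using hx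
    obtain ⟨z', hz'S, hxz'⟩ : ∃ z' ∈ S, x ∈ g.chronologicalFuture τ.reverse {z'} := by
      rw [chronologicalPast, chronologicalFuture_eq_biUnion] at h
      simpa only [mem_iUnion, exists_prop] using h
    exact IsCauchyHypersurface.isAchronal_holds hn hS z hzS z' hz'S
      (mem_chronologicalFuture_of_mem_causalFuture hn1 hxz
        (mem_chronologicalFuture_of_mem_chronologicalPast hxz'))

/-- **A future timelike curve from a boundary point `p ∈ ∂U ∩ J⁺(S)` stays outside `U`.** With
`S` achronal and `S ∩ U` a Cauchy hypersurface of `(U, g|_U, τ|_U)`: if `γ` is a future timelike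
curve on `[0, ε]` with `γ 0 = p ∈ J⁺(S) ∖ U`, then `γ t ∉ U` for `t ∈ (0, ε]` — otherwise `p ≪ γ t`
would be a timelike entry into `U` (`IsAchronal.mem_opens_of_mem_chronologicalFuture`). The first
sentence of the printed proof of Lemma 16: *"Then we have `γ((0, ε]) ⊆ Uᶜ`"*.
[cite: Sbierski2016AHP, §3.2, proof of Lemma 16 (arXiv numbering)] -/
theorem IsAchronal.notMem_opens_of_isFutureTimelikeCurveOn [T2Space M]
    [SecondCountableTopology M] [BoundarylessManifold I M] [FiniteDimensional ℝ E] (hn : 2 ≤ n)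
    (hres : PseudoRiemannianMetric.contMDiff_restrict (I := I) (n := n) (M := M))
    (hτ : τ.contMDiff_restrict) {S : Set M} (hA : g.IsAchronal τ S) {U : Opens M}
    (hU : (g.restrict hres U).IsCauchyHypersurface (τ.restrict hres hτ U) (Subtype.val ⁻¹' S))
    {γ : ℝ → M} {ε : ℝ} (hγ : g.IsFutureTimelikeCurveOn τ γ (Icc 0 ε))
    (hpS : γ 0 ∈ g.causalFuture τ S) (hpU : γ 0 ∉ U) {t : ℝ} (ht : t ∈ Ioc 0 ε) : γ t ∉ U :=
  fun htU ↦ hpU (hA.mem_opens_of_mem_chronologicalFuture hn hres hτ hU hpS htU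
    ⟨γ 0, rfl, γ, 0, t, ht.1, hγ.mono (Icc_subset_Icc_right ht.2), rfl, rfl⟩)

/-- **Sbierski 2016, Lemma 16 ("FuturePoint").** Let `S` be a Cauchy hypersurface of
`(M, g, τ)`, `U ⊆ M` open with `S ⊆ U` and `S ∩ U` a Cauchy hypersurface of `(U, g|_U, τ|_U)`,
and assume (global hyperbolicity of `M`) that `J⁻(x) ∩ J⁺(S)` is compact for every `x` and that
the causal relation is sequentially closed. If `p ∈ ∂U` satisfies `J⁻(p) ∩ ∂U ∩ J⁺(S) ⊆ {p}`,
then every neighbourhood `W` of `p` contains `J⁻(q) ∩ Uᶜ ∩ J⁺(S)` for some `q ≫ p`. Proof as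
printed (the hypothesis `p ∈ J⁺(S)` of the printed statement is not needed), with the final
contradiction supplied by `IsAchronal.mem_opens_of_mem_closure_of_mem_chronologicalFuture`.
[cite: Sbierski2016AHP, §3.2, Lemma 16 (arXiv numbering)] -/
theorem IsCauchyHypersurface.exists_causalPast_inter_compl_subset [T2Space M]
    [SecondCountableTopology M] [BoundarylessManifold I M] [FiniteDimensional ℝ E] (hn : 2 ≤ n)
    (hres : PseudoRiemannianMetric.contMDiff_restrict (I := I) (n := n) (M := M))
    (hτ : τ.contMDiff_restrict) {S : Set M} (hS : g.IsCauchyHypersurface τ S) {U : Opens M}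
    (hSU : S ⊆ U)
    (hU : (g.restrict hres U).IsCauchyHypersurface (τ.restrict hres hτ U) (Subtype.val ⁻¹' S))
    (hK : ∀ x : M, IsCompact (g.causalPast τ {x} ∩ g.causalFuture τ S))
    (hrel : ∀ {xs ys : ℕ → M} {x y : M}, Tendsto xs atTop (𝓝 x) → Tendsto ys atTop (𝓝 y) →
      (∀ j, ys j ∈ g.causalFuture τ {xs j}) → y ∈ g.causalFuture τ {x})
    {p : M} (hp : p ∈ frontier (U : Set M))
    (hsp : ∀ q ∈ g.causalPast τ {p} ∩ frontier (U : Set M) ∩ g.causalFuture τ S, q = p)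
    {W : Set M} (hW : W ∈ 𝓝 p) :
    ∃ q ∈ g.chronologicalFuture τ {p},
      g.causalPast τ {q} ∩ (U : Set M)ᶜ ∩ g.causalFuture τ S ⊆ W := by
  classical
  have hn1 : (1 : ℕ∞ω) ≤ n := le_trans one_le_two hn
  have hA : g.IsAchronal τ S := IsCauchyHypersurface.isAchronal_holds hn hS
  have hpU : p ∉ U := fun h ↦ (eq_empty_iff_forall_notMem.1 U.2.inter_frontier_eq) p ⟨h, hp⟩
  -- a future timelike curve `γ` from `p` on `[0, ε]`
  obtain ⟨γ, D, hγD, h0D, hγ0⟩ := exists_isEndlessTimelikeCurve_through (g := g) (τ := τ) hn p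
  obtain ⟨ε, hε, hεD⟩ : ∃ ε > 0, ε ∈ D := by
    by_contra hcon'
    push Not at hcon'
    have hDle : ∀ t ∈ D, t ≤ 0 := fun t ht ↦ not_lt.1 fun h ↦ hcon' t h ht
    refine hγD.2.2.1.2 (γ 0) ?_
    exact tendsto_atTop_of_eventually_const (i₀ := (⟨0, h0D⟩ : D)) fun i hi ↦
      congrArg γ (le_antisymm (hDle i i.2) hi)
  have hIcc : Icc 0 ε ⊆ D := hγD.1.out h0D hεD
  have hγt : g.IsFutureTimelikeCurveOn τ γ (Icc 0 ε) := hγD.2.1.mono hIcc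
  have hγc : g.IsFutureCausalCurveOn τ γ (Icc 0 ε) := hγt.isFutureCausalCurveOn
  have hcont0 : ContinuousAt γ 0 := (hγt 0 (left_mem_Icc.2 hε.le)).1.continuousAt
  have hpγ : ∀ t ∈ Ioc 0 ε, γ t ∈ g.chronologicalFuture τ {p} := fun t ht ↦
    ⟨p, rfl, γ, 0, t, ht.1, hγt.mono (Icc_subset_Icc_right ht.2), hγ0, rfl⟩
  -- suppose the conclusion fails for every `γ (ε / (j + 1))`
  by_contra hcon
  push Not at hcon
  set t : ℕ → ℝ := fun j ↦ ε / ((j : ℝ) + 1) with htdef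
  have htmem : ∀ j, t j ∈ Ioc 0 ε := fun j ↦ by
    have hj : (1 : ℝ) ≤ (j : ℝ) + 1 := by
      have := Nat.cast_nonneg (α := ℝ) j
      linarith
    exact ⟨by positivity, div_le_self hε.le hj⟩
  have hx : ∀ j, ∃ x, x ∈ g.causalPast τ {γ (t j)} ∩ (U : Set M)ᶜ ∩ g.causalFuture τ S ∧
      x ∉ W := fun j ↦ by
    obtain ⟨x, hx, hxW⟩ := not_subset.1 (hcon (γ (t j)) (hpγ (t j) (htmem j)))
    exact ⟨x, hx, hxW⟩
  choose x hxmem hxW using hx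
  -- all `x j` lie in the compact set `J⁻(γ ε) ∩ J⁺(S)`
  have hxK : ∀ j, x j ∈ g.causalPast τ {γ ε} ∩ g.causalFuture τ S := fun j ↦ by
    refine ⟨?_, (hxmem j).2⟩
    have h1 : γ (t j) ∈ g.causalFuture τ {x j} := mem_causalPast_singleton_iff.1 (hxmem j).1.1
    have h2 : γ ε ∈ g.causalFuture τ {γ (t j)} := by
      rcases eq_or_lt_of_le (htmem j).2 with h | h
      · rw [h]
        exact subset_causalFuture g τ _ rfl
      · exact Or.inr ⟨γ (t j), rfl, γ, t j, ε, h,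
          hγc.mono (Icc_subset_Icc_left (htmem j).1.le), rfl, rfl⟩
    exact mem_causalPast_singleton_iff.2
      (mem_causalFuture_of_mem_causalFuture_of_mem_causalFuture hn h1 h2)
  obtain ⟨q, hqK, φ, hφ, hlim⟩ := (hK (γ ε)).tendsto_subseq hxK
  -- `q ∉ U`, `q ∉ interior W`, `q ∈ J⁺(S)`, `q ≤ p`
  have hqU : q ∉ U :=
    U.2.isClosed_compl.mem_of_tendsto hlim (Eventually.of_forall fun j ↦ (hxmem (φ j)).1.2)
  have hqW : q ∉ interior W :=
    isOpen_interior.isClosed_compl.mem_of_tendsto hlim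
      (Eventually.of_forall fun j h ↦ hxW (φ j) (interior_subset h))
  have hqS : q ∈ g.causalFuture τ S := hqK.2
  have hqp : p ∈ g.causalFuture τ {q} := by
    refine hrel hlim ?_ fun j ↦ mem_causalPast_singleton_iff.1 (hxmem (φ j)).1.1
    have ht0 : Tendsto t atTop (𝓝 0) := by
      have h := (tendsto_one_div_add_atTop_nhds_zero_nat (𝕜 := ℝ)).const_mul ε
      rw [mul_zero] at h
      refine h.congr fun j ↦ ?_
      simp only [htdef]
      ring
    have h := (hcont0.tendsto.comp ht0).comp hφ.tendsto_atTop
    rw [hγ0] at h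
    exact h
  by_cases hqf : q ∈ frontier (U : Set M)
  · -- `q ∈ ∂U`: then `q = p`, but `p ∈ interior W`
    have hqeq := hsp q ⟨⟨mem_causalPast_singleton_iff.2 hqp, hqf⟩, hqS⟩
    exact hqW (hqeq ▸ mem_interior_iff_mem_nhds.2 hW)
  · -- `q` in the exterior of `U`: a point `r ≪ p` of the exterior near `q` would lie in `U`
    have hqcl : q ∉ closure (U : Set M) := by
      rw [closure_eq_self_union_frontier]
      exact fun h ↦ h.elim hqU hqf
    have hqI : q ∈ g.chronologicalFuture τ S :=
      hS.mem_chronologicalFuture_of_mem_causalFuture_diff hn hqS fun h ↦ hqU (hSU h)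
    have hqcl' : q ∈ closure (g.chronologicalPast τ {p}) :=
      causalFuture_subset_closure_chronologicalFuture_of_pushUp (τ := τ.reverse) hn {p}
        (mem_causalPast_singleton_iff.2 hqp)
    have hnhds : (closure (U : Set M))ᶜ ∩ g.chronologicalFuture τ S ∈ 𝓝 q :=
      inter_mem (isClosed_closure.isOpen_compl.mem_nhds hqcl)
        ((isOpen_chronologicalFuture_of_boundaryless g τ S).mem_nhds hqI)
    obtain ⟨r, ⟨hrcl, hrI⟩, hrp⟩ := mem_closure_iff_nhds.1 hqcl' _ hnhds
    have hrU : r ∈ U :=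
      hA.mem_opens_of_mem_closure_of_mem_chronologicalFuture hn hres hτ hU
        (chronologicalFuture_subset_causalFuture g τ S hrI) (frontier_subset_closure hp)
        (mem_chronologicalFuture_of_mem_chronologicalPast hrp)
    exact hrcl (subset_closure hrU)

end LorentzianMetric

end Literature.Geometry.Lorentzian

end
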